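import Summits.Ventures.Crystal3D.Theorems.StickyWulffConstantNoReconstructionGainLowCoordGeom
import Summits.Ventures.Crystal3D.Theorems.StickyWulffConstantNoReconstructionGainTriangularDiscUpper
import Summits.Ventures.Crystal3D.StickySpheres.TriangularDiscCount
import HarnessLib

/-!
# The rim of the `(111)` slab sample has `O(ρ)` sites

HONEST FRAMING. Part of the venture `Summits/Ventures/Crystal3D` (cell `crystal3d-full`), helper
`--supports` the crux `NoReconstructionGain` (stmt-Ventures-19144, route
`route-Ventures-StickyWulffConstant`; WK line, rung `LowCoordAdhesion111 9`).  Counting only: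
with `P` the slab sample at `ν = e₃`, `R = 4` (all sites of `fccStacking 1 √(2/3)` with
`−8 ≤ z ≤ −4` and lateral radius `≤ ρ`; five hexagonal layers `k = −9, …, −5`), the sites of
lateral radius `> ρ − 2` number at most `75 π ρ` for `ρ ≥ 4` (`card_rim_le`): per layer, the
upper disc count `(√3/2)·# ≤ π(ρ+2)²` (`triangular_disc_count_upper`) minus the lower count
`(2/√3)π(ρ−4)² ≤ #` of the inner disc (`triangular_disc_count`) is `≤ (2/√3)π(12ρ − 12) ≤ 15πρ`.
These rim sites are where the "bad" cross bonds of the adhesion bookkeeping live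
(`rim_of_lowPotential_partner`).

WHAT THIS IS NOT: nothing about packings beyond counting; rung F-C1 not moved.
-/

noncomputable section

namespace Summit.Ventures.Crystal3D.Theorems

open Summit.Ventures.Crystal3D Finset Real
open Literature.MathematicalPhysics.StatisticalMechanics (barlowPos barlowStacking fccStacking
  constHagg isHaggSeq_const haggLabel_const barlowPos_mem barlowPos_apply_zero barlowPos_apply_one
  barlowPos_apply_two le_dist_barlowPos_of_ideal)
open scoped InnerProductSpace

/-! ## The rim has `O(ρ)` sites -/

/-- **Rim count.**  With `P` the slab sample as above (`ρ ≥ 4`), the sites of `P` with lateral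
radius `> ρ − 2` number at most `75 π ρ`. -/
theorem card_rim_le (ρ : ℝ) (hρ : 4 ≤ ρ) (P : Finset (EuclideanSpace ℝ (Fin 3)))
    (hP : ∀ p, p ∈ P ↔ (p ∈ fccStacking 1 (Real.sqrt (2 / 3)) ∧ -8 ≤ p 2 ∧ p 2 ≤ -4 ∧
      p 0 ^ 2 + p 1 ^ 2 ≤ ρ ^ 2)) :
    ((P.filter fun p => (ρ - 2) ^ 2 < p 0 ^ 2 + p 1 ^ 2).card : ℝ) ≤ 75 * Real.pi * ρ := by
  classical
  obtain ⟨hh2, hh45, hh89⟩ := sqrt_two_thirds_bounds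
  set h : ℝ := Real.sqrt (2 / 3) with hhdef
  have hhpos : 0 < h := by linarith
  have hh : h ^ 2 = 2 / 3 * (1 : ℝ) ^ 2 := by rw [hh2]; ring
  have h3 : (0 : ℝ) < Real.sqrt 3 := Real.sqrt_pos.2 (by norm_num)
  have h3sq : Real.sqrt 3 ^ 2 = 3 := Real.sq_sqrt (by norm_num)
  have h3lo : (17 : ℝ) / 10 ≤ Real.sqrt 3 :=
    (pow_le_pow_iff_left₀ (by norm_num) h3.le two_ne_zero).1 (by rw [h3sq]; norm_num)
  have hfcc_inj : ∀ {k₁ a₁ b₁ k₂ a₂ b₂ : ℤ},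
      barlowPos 1 h constHagg k₁ a₁ b₁ = barlowPos 1 h constHagg k₂ a₂ b₂ →
        (k₁, a₁, b₁) = (k₂, a₂, b₂) := by
    intro k₁ a₁ b₁ k₂ a₂ b₂ heq
    by_contra hne
    have h1 := le_dist_barlowPos_of_ideal isHaggSeq_const one_pos hh hne
    rw [heq, dist_self] at h1
    exact absurd h1 (by norm_num)
  -- every sample site has integer coordinates with layer index in `[-9, -5]`
  have hcoord : ∀ p ∈ P, ∃ k i j : ℤ, -9 ≤ k ∧ k ≤ -5 ∧ p = barlowPos 1 h constHagg k i j := by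
    intro p hp
    obtain ⟨hΛ, hz1, hz2, -⟩ := (hP p).1 hp
    obtain ⟨k, i, j, rfl⟩ := hΛ
    rw [barlowPos_apply_two] at hz1 hz2
    refine ⟨k, i, j, ?_, ?_, rfl⟩
    · by_contra hk
      have : (k : ℝ) ≤ -10 := by exact_mod_cast (show k ≤ -10 by omega)
      nlinarith
    · by_contra hk
      have : (-4 : ℝ) ≤ k := by exact_mod_cast (show -4 ≤ k by omega)
      nlinarith
  -- layer by layer
  set K : Finset ℤ := Finset.Icc (-9) (-5) with hK
  have hKcard : K.card = 5 := by rw [hK]; rfl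
  set rim := P.filter fun p => (ρ - 2) ^ 2 < p 0 ^ 2 + p 1 ^ 2 with hrim
  set layer : ℤ → Finset (EuclideanSpace ℝ (Fin 3)) := fun k =>
    P.filter fun p => p 2 = (k : ℝ) * h with hlayer
  have hrim_sub : rim ⊆ K.biUnion fun k => (layer k).filter fun p => (ρ - 2) ^ 2 < p 0 ^ 2 + p 1 ^ 2 := by
    intro p hp
    rw [hrim, mem_filter] at hp
    obtain ⟨k, i, j, hk1, hk2, hpk⟩ := hcoord p hp.1
    rw [mem_biUnion]
    refine ⟨k, by rw [hK, Finset.mem_Icc]; exact ⟨hk1, hk2⟩, ?_⟩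
    rw [mem_filter, hlayer, mem_filter]
    exact ⟨⟨hp.1, by rw [hpk, barlowPos_apply_two]⟩, hp.2⟩
  -- per-layer bound via the two disc counts
  have hper : ∀ k ∈ K, (((layer k).filter fun p => (ρ - 2) ^ 2 < p 0 ^ 2 + p 1 ^ 2).card : ℝ)
      ≤ 15 * Real.pi * ρ := by
    intro k hk
    rw [hK, Finset.mem_Icc] at hk
    -- index map on the layer
    have hidx : ∀ p ∈ layer k, ∃ ij : ℤ × ℤ, p = barlowPos 1 h constHagg k ij.1 ij.2 := by
      intro p hp
      rw [hlayer, mem_filter] at hp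
      obtain ⟨k', i, j, -, -, hpk⟩ := hcoord p hp.1
      have : k' = k := by
        have hz := hp.2
        rw [hpk, barlowPos_apply_two] at hz
        have := mul_right_cancel₀ hhpos.ne' hz
        exact_mod_cast this
      exact ⟨(i, j), by rw [hpk, this]⟩
    set g : EuclideanSpace ℝ (Fin 3) → ℤ × ℤ := fun p =>
      if hq : ∃ ij : ℤ × ℤ, p = barlowPos 1 h constHagg k ij.1 ij.2 then hq.choose else (0, 0)
      with hg
    have hg_spec : ∀ p ∈ layer k, p = barlowPos 1 h constHagg k (g p).1 (g p).2 := by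
      intro p hp
      have hex := hidx p hp
      rw [hg]; simp only [hex, dif_pos]
      exact hex.choose_spec
    have hg_inj : Set.InjOn g ↑(layer k) := by
      intro p hp p' hp' hpp
      rw [hg_spec p (mem_coe.1 hp), hg_spec p' (mem_coe.1 hp'), hpp]
    -- lateral radius of a layer-`k` site in coordinates
    have hlat : ∀ i j : ℤ, barlowPos 1 h constHagg k i j 0 ^ 2 + barlowPos 1 h constHagg k i j 1 ^ 2 =
        ((i : ℝ) + (j : ℝ) / 2 - (-(k : ℝ) / 2)) ^ 2 +
          (Real.sqrt 3 / 2 * (j : ℝ) - (-(Real.sqrt 3 / 6 * k))) ^ 2 := by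
      intro i j
      rw [barlowPos_apply_zero, barlowPos_apply_one, haggLabel_const]; push_cast; ring
    -- upper count for the whole layer
    set Tup : Finset (ℤ × ℤ) := (layer k).image g with hTup
    have hup := triangular_disc_count_upper (-(k : ℝ) / 2) (-(Real.sqrt 3 / 6 * k)) ρ (by linarith)
      Tup (by
        intro ij hij
        rw [hTup, mem_image] at hij
        obtain ⟨p, hp, rfl⟩ := hij
        have hpP : p ∈ P := (mem_filter.1 (show p ∈ layer k from hp)).1
        have hl := ((hP p).1 hpP).2.2.2
        rw [hg_spec p hp, hlat] at hl
        exact hl)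
    have hTup_card : Tup.card = (layer k).card := by rw [hTup, card_image_of_injOn hg_inj]
    -- lower count for the inner disc
    set inner := (layer k).filter fun p => p 0 ^ 2 + p 1 ^ 2 ≤ (ρ - 2) ^ 2 with hinner
    set Tlo : Finset (ℤ × ℤ) := inner.image g with hTlo
    have hlo := triangular_disc_count (-(k : ℝ) / 2) (-(Real.sqrt 3 / 6 * k)) (ρ - 2) (by linarith)
      Tlo (by
        intro i j hcond
        set p := barlowPos 1 h constHagg k i j with hpdef
        have hl : p 0 ^ 2 + p 1 ^ 2 ≤ (ρ - 2) ^ 2 := by rw [hpdef, hlat]; exact hcond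
        have hpP : p ∈ P := by
          rw [hP]
          refine ⟨barlowPos_mem _ _ _, ?_, ?_, by nlinarith⟩
          · rw [hpdef, barlowPos_apply_two]
            have : (-9 : ℝ) ≤ k := by exact_mod_cast hk.1
            nlinarith
          · rw [hpdef, barlowPos_apply_two]
            have : (k : ℝ) ≤ -5 := by exact_mod_cast hk.2
            nlinarith
        have hpl : p ∈ layer k := by
          rw [hlayer, mem_filter]; exact ⟨hpP, by rw [hpdef, barlowPos_apply_two]⟩
        have hpi : p ∈ inner := by rw [hinner, mem_filter]; exact ⟨hpl, hl⟩
        have hgp : g p = (i, j) := by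
          have := hfcc_inj ((hg_spec p hpl).symm.trans hpdef)
          simp only [Prod.mk.injEq] at this
          exact Prod.ext this.2.1 this.2.2
        rw [hTlo, mem_image]; exact ⟨p, hpi, hgp⟩)
    have hTlo_card : Tlo.card = inner.card := by
      rw [hTlo, card_image_of_injOn fun p hp p' hp' hpp =>
        hg_inj (mem_coe.2 (mem_filter.1 (mem_coe.1 hp)).1)
          (mem_coe.2 (mem_filter.1 (mem_coe.1 hp')).1) hpp]
    -- rim of the layer = layer minus inner disc
    have hsplit : ((layer k).filter fun p => (ρ - 2) ^ 2 < p 0 ^ 2 + p 1 ^ 2).card + inner.card =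
        (layer k).card := by
      rw [hinner]
      have := card_filter_add_card_filter_not (s := layer k) (fun p => (ρ - 2) ^ 2 < p 0 ^ 2 + p 1 ^ 2)
      rw [← this]
      congr 2
      exact filter_congr fun p _ => by simp [not_lt]
    have e1 : (((layer k).filter fun p => (ρ - 2) ^ 2 < p 0 ^ 2 + p 1 ^ 2).card : ℝ) =
        (Tup.card : ℝ) - (Tlo.card : ℝ) := by
      rw [hTup_card, hTlo_card]
      have : (((layer k).filter fun p => (ρ - 2) ^ 2 < p 0 ^ 2 + p 1 ^ 2).card : ℝ) +
          (inner.card : ℝ) = ((layer k).card : ℝ) := by exact_mod_cast hsplit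
      linarith
    rw [e1]
    -- `(√3/2) #Tup ≤ π (ρ+2)²`, `(2/√3) π (ρ-4)² ≤ #Tlo`
    have hup' : (Tup.card : ℝ) ≤ 2 / Real.sqrt 3 * (Real.pi * (ρ + 2) ^ 2) := by
      rw [div_mul_eq_mul_div, le_div_iff₀ h3]; linarith
    have hlo' : 2 / Real.sqrt 3 * Real.pi * (ρ - 2 - 2) ^ 2 ≤ (Tlo.card : ℝ) := hlo
    have hdiff : 2 / Real.sqrt 3 * (Real.pi * (ρ + 2) ^ 2) - 2 / Real.sqrt 3 * Real.pi * (ρ - 2 - 2) ^ 2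
        = 2 / Real.sqrt 3 * Real.pi * (12 * ρ - 12) := by ring
    have h23 : 2 / Real.sqrt 3 ≤ 20 / 17 := by
      rw [div_le_div_iff₀ h3 (by norm_num)]; linarith
    have hpos : 0 ≤ Real.pi * (12 * ρ - 12) := by nlinarith [Real.pi_pos]
    calc (Tup.card : ℝ) - Tlo.card
        ≤ 2 / Real.sqrt 3 * (Real.pi * (ρ + 2) ^ 2) - 2 / Real.sqrt 3 * Real.pi * (ρ - 2 - 2) ^ 2 := by
          linarith
      _ = 2 / Real.sqrt 3 * (Real.pi * (12 * ρ - 12)) := by rw [hdiff]; ring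
      _ ≤ 20 / 17 * (Real.pi * (12 * ρ - 12)) := mul_le_mul_of_nonneg_right h23 hpos
      _ ≤ 15 * Real.pi * ρ := by nlinarith [Real.pi_pos]
  -- sum over the five layers
  calc (rim.card : ℝ)
      ≤ ((K.biUnion fun k => (layer k).filter fun p => (ρ - 2) ^ 2 < p 0 ^ 2 + p 1 ^ 2).card : ℝ) := by
        exact_mod_cast card_le_card hrim_sub
    _ ≤ ∑ k ∈ K, (((layer k).filter fun p => (ρ - 2) ^ 2 < p 0 ^ 2 + p 1 ^ 2).card : ℝ) := by
        exact_mod_cast card_biUnion_le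
    _ ≤ ∑ _k ∈ K, 15 * Real.pi * ρ := sum_le_sum hper
    _ = 75 * Real.pi * ρ := by rw [sum_const, hKcard]; ring

end Summit.Ventures.Crystal3D.Theorems

end
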